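import Summits.ResolutionOfSingularities.ResolutionOfSingularities.Theorems.CurveCutKernels
import HarnessLib

/-!
# CurveCutCells — decomp-res node «CurveCut» (lens-4 g35, critic row 199 BOOKED 0), tree file 2/3 of the node

Content VERBATIM from the decomp-res lens-4 g35 node `HOME/decomp-res-lens-4/g35/CurveCut.lean` (pin bedce505; no
carry, imports the landed tree only; namespace `…Theorems.HugValuationCut`); HOME = run/shared/lean/pub/decomp-res;
critic CRITIC-LEDGER row 199 BOOKED 0 (MAP (M-CurveLaw)); landing orders INBOX :1236 (08:49:13Z) — provenance,
critic text and the lens header in full in the first file of the node, `CurveCutKernels`.  `--kind proof --supports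
stmt-ResolutionOfSingularities-28338`.

## This file

§113 (g35 · NEW) THE CELLS OF THE CUT OF CELL C BY RING DIMENSION AND BY THE LINE LETTER, BY NAME (cn26, tagged as in g33/g34), AND THE HYPOTHESIS-FREE RE-LOCATIONS (`section LineCells`): the terminate-predicates and `NoWild…Towers` classes of C₃ (occult divisorial ∧ threefold; UNDECIDED = C₃♮), C₄ (∧ non-threefold; UNDECIDED · EXPECTED-HABITAT rd 4), C₃ˡ (∧ follows a line; DECIDED — EMPTY in kernel: `wildOccultDivisorialThreefoldLineMixed_holds`, `noWildOccultDivisorialThreefoldLineMixedTowers_holds`), C₃♮ (∧ follows NO line; UNDECIDED — the ruled / kangaroo core); the splits `wildOccultDivisorialMixed_split` (C = C₃ ∧ C₄), `wildOccultDivisorialThreefoldMixed_split` (C₃ = C₃ˡ ∧ C₃♮); the exact re-locations `…_iff_g35` (C₃ ⟺ C₃♮, C ⟺ C₃♮ ∧ C₄, g34 residual ⟺ **`NoWildOccultNonLineMixedTowers`** := (C₃♮ ∧ C₄) ∧ D₄ — THE LOCATED RESIDUAL of the lens-4 NP column after g35, whose cone-free HOME is this file —, g33 / g32 / g31 residuals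 likewise) and the up-links `noWildOccultNonLineMixedTowers_of_g34` / `_of_g32` / `_of_aside` (from the TREE aside `NoWildContactFreeOffLocusTowers`).

[WRITER NOTE (decomp-res writer g13): file split only, at the node's own `══ FILE` markers (tree files ≤ 400 lines);
namespace, sections, section variables, the sub-namespaces `CornerGame` / `CornerGame.CornerState` and every
declaration exactly as in the lens (the node's HOME-only dupNamespace-linter line is dropped — the library sets it;
`noncomputable section` and the namespace-level `open` lines of the node are replayed in `CurveCutKernels` /
`CurveCutCells`; `CurveCutCornerGame` imports `Mathlib` + `HarnessLib` only, as the marker says, so it carries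
neither — §114 names no tree declaration).]

(Sources: CossartPiltant2008 Prop. 4.4 (weighted-order chain law); Matsumura1987 Thms. 14.3, 17.8 (regular systems
of parameters); Hironaka1964 Ch. III; Giraud1975; CossartJannsenSaito2020 Thm. 6.40, Ch. 8; Hauser2010Kangaroo;
HauserPerlega2019 §2; Kollar2007 3.58–3.60; StacksProject 00NQ / 0AFT.)
-/

noncomputable section

open CategoryTheory AlgebraicGeometry IsLocalRing TopologicalSpace
open Literature.AlgebraicGeometry.Resolution
open Summit.ResolutionOfSingularities.ResolutionOfSingularities.Theorems
open WeakOrderReduction ForcedTowerClasses DivergentTowerClasses MonomialTowerClasses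
open HugDimensionClasses HugDimensionKernels SurfaceShadowClasses SurfaceShadowKernels
open NearPointCut (SingularClass)
open Scheme.IdealSheafData (vanishingIdeal)
open scoped BigOperators

namespace Summit.ResolutionOfSingularities.ResolutionOfSingularities.Theorems.HugValuationCut

section LineCells

/-! ## ══ FILE 2/3 `Theorems/CurveCutCells.lean` (§113; cone-free: imports FILE 1) ══ -/

/-! ## §113 (g35 · NEW) THE CELLS OF THE CUT OF CELL C BY RING DIMENSION AND BY THE LINE LETTER, BY NAME, AND THE
HYPOTHESIS-FREE RE-LOCATIONS

CELL C (g33, `NoWildOccultDivisorialMixedTowers`, «the occult divisorial tower») = C₃ ∧ C₄ exactly (excluded middle on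
`ThreefoldTower`), and C₃ = C₃ˡ ∧ C₃♮ exactly (excluded middle on `FollowsLineTower`); C₃ˡ («the occult divisorial threefold
tower that follows a line») DECIDED — EMPTY IN KERNEL (§112, port-free); C₃♮ («… that follows NO line») UNDECIDED — THE RULED /
KANGAROO CORE (desk/DESK-g35.md §3 and NODE-g35.md «Honest tags»: the desk trichotomy «isolated companion tail ∨
curve-followed ∨ ruled-recurrent»); C₄ UNDECIDED ·
EXPECTED-HABITAT rd 4.  HONEST TAG on C₃ˡ: the sub-kind is stated by mechanism (compatible regular parameters following one
regular curve germ) and killed by a NEW kernel law; it is ALSO where no inhabitant of C was ever expected — an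
(untyped, routine)
spreading bridge `FollowsLineTower T → CurveHugging T` (spread `(y₂, y₃)` to the reduced curve germ and identify its strict
transforms) would kill it a second time by the letter `¬ CurveHugging` of `SingularClass`; the kernel law is the
PORT-FREE kill and
the regular-curve half of the port `CurveLaw` of the closed hug-dimension-1 column.  Re-locations, all
HYPOTHESIS-FREE: C ⟺ C₃♮ ∧
C₄; the g34 located residual `NoWildOccultDivisorialOrNonThreefoldMixedTowers` (= C ∧ D₄) ⟺ (C₃♮ ∧ C₄) ∧ D₄ =:
`NoWildOccultNonLineMixedTowers` (THE LOCATED RESIDUAL after g35); the g33 occult residual, the g32 and the g31 residuals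
likewise. -/

/-- **CELL C₃ (occult divisorial ∧ THREEFOLD)** — UNDECIDED (= C₃ˡ ∧ C₃♮, C₃ˡ decided): letters = all of CELL C's
(g33) AND every
marked local ring has dimension 3.  Root letters-inhabitant: (O1) `(y² + x³(x+u)²)·(y², u³, yu²)` over `𝔽₂`, `n = 4` (g33 §104;
its forced tower DIES by stage 5 in every branch — desk (d2) of desk/DESK-g35.md — so it roots no tower, as the
thesis predicts). -/
def WildOccultDivisorialThreefoldMixedWallFreeFreshJumpShallowCompanionKangarooTowersTerminate (n : ℕ) : Prop :=
  NoTowerWild n fun T => (((MixedResidual n T ∧ ¬ (LatentFactorTower T ∧ ThreefoldTower T)) ∧ ¬ LatentFactorTower T) ∧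
    DivisorialTower T) ∧ ThreefoldTower T

/-- **CELL C₄ (occult divisorial ∧ NON-THREEFOLD)** — UNDECIDED · honest tag EXPECTED-HABITAT rd 4 (the occult divisorial
tower some of whose marked local rings have dimension ≠ 3; beside CELLS B and D₄ in the ring-dimension-4 column), NO certified
inhabitant on record.  The line-following law does not bite (a ring-dimension-3 law). -/
def WildOccultDivisorialNonThreefoldMixedWallFreeFreshJumpShallowCompanionKangarooTowersTerminate (n : ℕ) : Prop :=
  NoTowerWild n fun T => (((MixedResidual n T ∧ ¬ (LatentFactorTower T ∧ ThreefoldTower T)) ∧ ¬ LatentFactorTower T) ∧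
    DivisorialTower T) ∧ ¬ ThreefoldTower T

/-- **CELL C₃ˡ (occult divisorial threefold ∧ FOLLOWS A LINE)** — DECIDED: EMPTY IN KERNEL (`noTowerWild_threefold_followsLine`,
port-free).  Structural sub-kind stated by mechanism: compatible regular parameters `(u_j; y₂⁽ʲ⁾, y₃⁽ʲ⁾)` from some stage on,
`φ u = u'`, `φ y_i = u' y_i'` — the marked points run along one regular curve germ for ever. -/
def WildOccultDivisorialThreefoldLineMixedWallFreeFreshJumpShallowCompanionKangarooTowersTerminate (n : ℕ) : Prop :=
  NoTowerWild n fun T => ((((MixedResidual n T ∧ ¬ (LatentFactorTower T ∧ ThreefoldTower T)) ∧ ¬ LatentFactorTower T) ∧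
    DivisorialTower T) ∧ ThreefoldTower T) ∧ FollowsLineTower T

/-- **CELL C₃♮ (occult divisorial threefold ∧ FOLLOWS NO LINE) · part of THE LOCATED RESIDUAL after g35 — «THE OCCULT
DIVISORIAL THREEFOLD TOWER THAT RUNS ALONG NO REGULAR CURVE GERM»** — UNDECIDED · THE RULED / KANGAROO CORE: by the
desk structure
trichotomy of desk/DESK-g35.md §3 such a tower has, for its principal companion `h` of weight `a ≥ 2`, EITHER an
isolated companion tail
(`Top(h_j, a) = {x_j}` for all large `j`: the re-rooted tower is PRINCIPAL-ROOTED — closed column, consumption by name) OR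
infinitely many RULED BIRTHS (stages where the initial form of the companion is an `a`-th power of a linear form and a new
`a`-fold line of the companion surface is born inside the new exceptional plane) — the wild core, no law on record. -/
def WildOccultDivisorialThreefoldNonLineMixedWallFreeFreshJumpShallowCompanionKangarooTowersTerminate (n : ℕ) : Prop :=
  NoTowerWild n fun T => ((((MixedResidual n T ∧ ¬ (LatentFactorTower T ∧ ThreefoldTower T)) ∧ ¬ LatentFactorTower T) ∧
    DivisorialTower T) ∧ ThreefoldTower T) ∧ ¬ FollowsLineTower T

/-- **EXACT (pure logic): CELL C = C₃ ∧ C₄.** [folklore] -/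
theorem wildOccultDivisorialMixed_split (n : ℕ) :
    WildOccultDivisorialMixedWallFreeFreshJumpShallowCompanionKangarooTowersTerminate n ↔
      WildOccultDivisorialThreefoldMixedWallFreeFreshJumpShallowCompanionKangarooTowersTerminate n ∧
        WildOccultDivisorialNonThreefoldMixedWallFreeFreshJumpShallowCompanionKangarooTowersTerminate n :=
  noTowerWild_split _ ThreefoldTower

/-- **EXACT (pure logic): CELL C₃ = C₃ˡ ∧ C₃♮.** [folklore] -/
theorem wildOccultDivisorialThreefoldMixed_split (n : ℕ) :
    WildOccultDivisorialThreefoldMixedWallFreeFreshJumpShallowCompanionKangarooTowersTerminate n ↔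
      WildOccultDivisorialThreefoldLineMixedWallFreeFreshJumpShallowCompanionKangarooTowersTerminate n ∧
        WildOccultDivisorialThreefoldNonLineMixedWallFreeFreshJumpShallowCompanionKangarooTowersTerminate n :=
  noTowerWild_split _ FollowsLineTower

/-- **CELL C₃ˡ IS EMPTY (KERNEL, every `n`).** [folklore] -/
theorem wildOccultDivisorialThreefoldLineMixed_holds (n : ℕ) :
    WildOccultDivisorialThreefoldLineMixedWallFreeFreshJumpShallowCompanionKangarooTowersTerminate n :=
  noTowerWild_mono (fun _ h => ⟨h.1.1, h.1.2, h.2⟩) (noTowerWild_threefold_followsLine n fun T =>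
    ((MixedResidual n T ∧ ¬ (LatentFactorTower T ∧ ThreefoldTower T)) ∧ ¬ LatentFactorTower T) ∧ DivisorialTower T)

/-- **EXACT RE-LOCATION OF CELL C₃, HYPOTHESIS-FREE: C₃ ⟺ C₃♮.** [folklore] -/
theorem wildOccultDivisorialThreefoldMixed_iff_g35 (n : ℕ) :
    WildOccultDivisorialThreefoldMixedWallFreeFreshJumpShallowCompanionKangarooTowersTerminate n ↔
      WildOccultDivisorialThreefoldNonLineMixedWallFreeFreshJumpShallowCompanionKangarooTowersTerminate n :=
  (wildOccultDivisorialThreefoldMixed_split n).trans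
    ⟨fun h => h.2, fun h => ⟨wildOccultDivisorialThreefoldLineMixed_holds n, h⟩⟩

/-- **EXACT RE-LOCATION OF CELL C, HYPOTHESIS-FREE: C ⟺ C₃♮ ∧ C₄.** [folklore] -/
theorem wildOccultDivisorialMixed_iff_g35 (n : ℕ) :
    WildOccultDivisorialMixedWallFreeFreshJumpShallowCompanionKangarooTowersTerminate n ↔
      WildOccultDivisorialThreefoldNonLineMixedWallFreeFreshJumpShallowCompanionKangarooTowersTerminate n ∧
        WildOccultDivisorialNonThreefoldMixedWallFreeFreshJumpShallowCompanionKangarooTowersTerminate n :=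
  (wildOccultDivisorialMixed_split n).trans (Iff.and (wildOccultDivisorialThreefoldMixed_iff_g35 n) Iff.rfl)

/-- **EXACT RE-LOCATION OF THE g32 RESIDUAL, HYPOTHESIS-FREE (every `n ≥ 1`): `R32 ⟺ B ∧ (C₃♮ ∧ C₄) ∧ D₄`.** [folklore] -/
theorem wildMixedWallFreeFreshJumpShallow_iff_g35 {n : ℕ} (hn : 1 ≤ n) :
    WildMixedWallFreeFreshJumpShallowCompanionKangarooTowersTerminate n ↔
      WildLatentFactorNonThreefoldMixedWallFreeFreshJumpShallowCompanionKangarooTowersTerminate n ∧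
        ((WildOccultDivisorialThreefoldNonLineMixedWallFreeFreshJumpShallowCompanionKangarooTowersTerminate n ∧
            WildOccultDivisorialNonThreefoldMixedWallFreeFreshJumpShallowCompanionKangarooTowersTerminate n) ∧
          WildOccultNonDivisorialNonThreefoldMixedWallFreeFreshJumpShallowCompanionKangarooTowersTerminate n) :=
  (wildMixedWallFreeFreshJumpShallow_iff_g34 hn).trans
    (Iff.and Iff.rfl (Iff.and (wildOccultDivisorialMixed_iff_g35 n) Iff.rfl))

/-- BY NAME: **no wild OCCULT DIVISORIAL THREEFOLD mixed tower** (CELL C₃; UNDECIDED, = C₃♮ exactly). -/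
def NoWildOccultDivisorialThreefoldMixedTowers : Prop :=
  ∀ n : ℕ, 1 ≤ n → WildOccultDivisorialThreefoldMixedWallFreeFreshJumpShallowCompanionKangarooTowersTerminate n

/-- BY NAME: **no wild OCCULT DIVISORIAL NON-THREEFOLD mixed tower** (CELL C₄; UNDECIDED · EXPECTED-HABITAT rd 4). -/
def NoWildOccultDivisorialNonThreefoldMixedTowers : Prop :=
  ∀ n : ℕ, 1 ≤ n → WildOccultDivisorialNonThreefoldMixedWallFreeFreshJumpShallowCompanionKangarooTowersTerminate n

/-- BY NAME: **no wild OCCULT DIVISORIAL THREEFOLD mixed tower THAT FOLLOWS A LINE** (CELL C₃ˡ; DECIDED in kernel). -/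
def NoWildOccultDivisorialThreefoldLineMixedTowers : Prop :=
  ∀ n : ℕ, 1 ≤ n → WildOccultDivisorialThreefoldLineMixedWallFreeFreshJumpShallowCompanionKangarooTowersTerminate n

/-- BY NAME: **no wild OCCULT DIVISORIAL THREEFOLD mixed tower THAT FOLLOWS NO LINE** (CELL C₃♮; UNDECIDED — the ruled /
kangaroo core). -/
def NoWildOccultDivisorialThreefoldNonLineMixedTowers : Prop :=
  ∀ n : ℕ, 1 ≤ n → WildOccultDivisorialThreefoldNonLineMixedWallFreeFreshJumpShallowCompanionKangarooTowersTerminate n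

/-- BY NAME: **THE LOCATED RESIDUAL of the lens-4 NP column after g35 — «no wild occult mixed tower that (is divisorial
threefold and follows no line) or is not a threefold»** = (C₃♮ ∧ C₄) ∧ D₄. -/
def NoWildOccultNonLineMixedTowers : Prop :=
  (NoWildOccultDivisorialThreefoldNonLineMixedTowers ∧ NoWildOccultDivisorialNonThreefoldMixedTowers) ∧
    NoWildOccultNonDivisorialNonThreefoldMixedTowers

/-- **CELL C₃ˡ DECIDED BY NAME (kernel).** [folklore] -/
theorem noWildOccultDivisorialThreefoldLineMixedTowers_holds : NoWildOccultDivisorialThreefoldLineMixedTowers := fun n _ =>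
  wildOccultDivisorialThreefoldLineMixed_holds n

/-- **EXACT RE-LOCATION BY NAME, HYPOTHESIS-FREE: CELL C₃ ⟺ CELL C₃♮.** [folklore] -/
theorem noWildOccultDivisorialThreefoldMixedTowers_iff_g35 :
    NoWildOccultDivisorialThreefoldMixedTowers ↔ NoWildOccultDivisorialThreefoldNonLineMixedTowers :=
  ⟨fun h n hn => (wildOccultDivisorialThreefoldMixed_iff_g35 n).mp (h n hn),
    fun h n hn => (wildOccultDivisorialThreefoldMixed_iff_g35 n).mpr (h n hn)⟩

/-- **EXACT RE-LOCATION BY NAME, HYPOTHESIS-FREE: CELL C ⟺ C₃♮ ∧ C₄.** [folklore] -/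
theorem noWildOccultDivisorialMixedTowers_iff_g35 :
    NoWildOccultDivisorialMixedTowers ↔
      NoWildOccultDivisorialThreefoldNonLineMixedTowers ∧ NoWildOccultDivisorialNonThreefoldMixedTowers :=
  ⟨fun h => ⟨fun n hn => ((wildOccultDivisorialMixed_iff_g35 n).mp (h n hn)).1,
      fun n hn => ((wildOccultDivisorialMixed_iff_g35 n).mp (h n hn)).2⟩,
    fun h n hn => (wildOccultDivisorialMixed_iff_g35 n).mpr ⟨h.1 n hn, h.2 n hn⟩⟩

/-- **EXACT RE-LOCATION BY NAME, HYPOTHESIS-FREE: the g34 located residual (= C ∧ D₄) ⟺ (C₃♮ ∧ C₄) ∧ D₄ (the g35 located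
residual).** [folklore] -/
theorem noWildOccultDivisorialOrNonThreefoldMixedTowers_iff_g35 :
    NoWildOccultDivisorialOrNonThreefoldMixedTowers ↔ NoWildOccultNonLineMixedTowers :=
  Iff.and noWildOccultDivisorialMixedTowers_iff_g35 Iff.rfl

/-- **EXACT RE-LOCATION BY NAME, HYPOTHESIS-FREE: the g33 occult residual `NoWildOccultMixedTowers` (= C ∧ D) ⟺ the g35 located
residual.** [folklore] -/
theorem noWildOccultMixedTowers_iff_g35 : NoWildOccultMixedTowers ↔ NoWildOccultNonLineMixedTowers :=
  noWildOccultMixedTowers_iff_g34.trans noWildOccultDivisorialOrNonThreefoldMixedTowers_iff_g35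

/-- **EXACT RE-LOCATION BY NAME, HYPOTHESIS-FREE: the g32 residual ⟺ CELL B ∧ the g35 located residual.** [folklore] -/
theorem noWildMixedWallFreeFreshJumpShallowCompanionKangarooTowers_iff_g35 :
    NoWildMixedWallFreeFreshJumpShallowCompanionKangarooTowers ↔
      NoWildLatentFactorNonThreefoldMixedTowers ∧ NoWildOccultNonLineMixedTowers :=
  noWildMixedWallFreeFreshJumpShallowCompanionKangarooTowers_iff_g34.trans
    ⟨fun h => ⟨h.1, noWildOccultDivisorialOrNonThreefoldMixedTowers_iff_g35.mp ⟨h.2.1, h.2.2⟩⟩,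
      fun h => ⟨h.1, noWildOccultDivisorialOrNonThreefoldMixedTowers_iff_g35.mpr h.2⟩⟩

/-- **EXACT RE-LOCATION BY NAME, HYPOTHESIS-FREE: the g31 residual ⟺ CELL B ∧ the g35 located residual.** [folklore] -/
theorem noWildNonSurfaceWallFreeFreshJumpShallowCompanionKangarooTowers_iff_g35 :
    NoWildNonSurfaceWallFreeFreshJumpShallowCompanionKangarooTowers ↔
      NoWildLatentFactorNonThreefoldMixedTowers ∧ NoWildOccultNonLineMixedTowers :=
  noWildNonSurfaceWallFreeFreshJumpShallowCompanionKangarooTowers_iff_g32.trans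
    noWildMixedWallFreeFreshJumpShallowCompanionKangarooTowers_iff_g35

/-- up-link (hypothesis-free): the g35 located residual ⟸ the g34 located residual. [folklore] -/
theorem noWildOccultNonLineMixedTowers_of_g34 (h : NoWildOccultDivisorialOrNonThreefoldMixedTowers) :
    NoWildOccultNonLineMixedTowers :=
  noWildOccultDivisorialOrNonThreefoldMixedTowers_iff_g35.mp h

/-- up-link (hypothesis-free): the g35 located residual ⟸ the g32 residual. [folklore] -/
theorem noWildOccultNonLineMixedTowers_of_g32 (h : NoWildMixedWallFreeFreshJumpShallowCompanionKangarooTowers) :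
    NoWildOccultNonLineMixedTowers :=
  (noWildMixedWallFreeFreshJumpShallowCompanionKangarooTowers_iff_g35.mp h).2

/-- up-link from the TREE aside `NoWildContactFreeOffLocusTowers` (hypothesis-free). [folklore] -/
theorem noWildOccultNonLineMixedTowers_of_aside (h : NoWildContactFreeOffLocusTowers) : NoWildOccultNonLineMixedTowers :=
  noWildOccultNonLineMixedTowers_of_g34 (noWildOccultDivisorialOrNonThreefoldMixedTowers_of_aside h)

end LineCells

end Summit.ResolutionOfSingularities.ResolutionOfSingularities.Theorems.HugValuationCut
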